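import Summits.ResolutionOfSingularities.ResolutionOfSingularities.Theorems.EquisingularLiftEquisingularLiftNatSubchainSupplierDriverCluster
import Summits.ResolutionOfSingularities.ResolutionOfSingularities.Theorems.EquisingularLiftEquisingularLiftNatTCPlusPlusInvBase
import Summits.ResolutionOfSingularities.ResolutionOfSingularities.Theorems.EquisingularLiftEquisingularLiftNatTCPlusPlusInvStep
import Summits.ResolutionOfSingularities.ResolutionOfSingularities.Theorems.EquisingularLiftEquisingularLiftNatTCPlusPlusInvFinal
import HarnessLib

/-!
# [OURS · L1 W4.5(b) · EL♮(3)] (δ) ASSEMBLY: HSUB′(ReachTCPlusPlus₂)₃ — THE SUB-CHAIN SUPPLIER OF RUNG v7′ (TC⁺⁺) AT RELATIVE DIMENSION `3`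
# = res-L1-w45b-stub-3's driver `hsub_reachTCPlusPlus_of_invariant` (p543222) at `INV := TCPlusPlus.Inv` (p547095) with
# (base) = res-type-100's `inv_base″`, (step) = `inv_step″`, (final) = `inv_final″`

Crux chain w45b (cell `res-hironaka`, slot W4.5(b)), working crux **EL♮** = stmt-ResolutionOfSingularities-20038, child **EL♮(3)** =
stmt-ResolutionOfSingularities-20148, route EquisingularLift, line `sections`, registered stub `stub_elnat_tcPlusPlusPointResolution` (v2) —
the `hsub` premise of res-L1-w45b-lead-2's INST `stub_elnat_tcPlusPlusTangentPointResolution_of_subchainLift` (p538683) at `n = 3`.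
HONEST FRAMING: OURS; NOT a statement of any manuscript; AI-written, weaker than expert review. No `sorry`; standard axioms. DEF-FREE.
`--supports stmt-ResolutionOfSingularities-20148 --as helper` (res-type-100 g12; CHAIN v7.29 ask (e) «the first (δ) ASSEMBLY filing»).

STATEMENT = the driver's statement (…NatSubchainSupplierDriverCluster p543222) with `n := 3` and the three invariant hypotheses DISCHARGED:
the common K5′ prefix, then `∀ F₁₀ β T₁₀, ReachTCPlusPlus₂ F₁ F₂ υ x (closure υ⁻¹(T₁ ∖ {x})) F₁₀ β T₁₀ → ∃ X₉ σ₉ S₉ j₉ t₉, …`.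
PROOF = `hsub_reachTCPlusPlus_of_invariant k 3 … (TCPlusPlus.Inv O k θ P q Y Ch) inv_base″ inv_step″ inv_final″`.
Credits (bricks): res-L1-w45b-stub-3 (driver, INV″ Defs, D1, D2, D4, T-CLUSTER-LIFT), res-D-pv-051 (D3a, frame lift, cone rounds), res-L1-w45b-stub-2
(T-PTPRIME-DICT, B5, T-DIRLIFT currency), res-L1-w45b-stub-4 ((A), descends), res-L1-w45b-stub-1 (INV DEFS v3, (ε)-core, curve step, driver pattern),
res-D-pv-029 (K5′, B1★, package transport), res-D-pv-032 / res-type-097 / res-type-027 (Δ-criterion, T-TCONE, charts), res-type-100 (T-CARRIER-Δ,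
T-FRAME-AT, inv_base B-series, D3/D5/D6, inv_step″/inv_final″).
-/

set_option linter.dupNamespace false -- mandated namespace `Summit.<Summit>.<Problem>` of this single-conjunct summit
set_option linter.overlappingInstances false -- signatures carry `[IsDomain O] [IsDiscreteValuationRing O]`

noncomputable section

open CategoryTheory CategoryTheory.Limits AlgebraicGeometry TopologicalSpace Topology IsLocalRing
open Literature.AlgebraicGeometry.Resolution
open AlgebraicGeometry.Scheme.IdealSheafData

namespace Summit.ResolutionOfSingularities.ResolutionOfSingularities.Cruxes.EquisingularLiftNat.Sections

/-- **HSUB′(ReachTCPlusPlus₂)₃ — the sub-chain supplier for the v7′ rung (TC⁺⁺) at relative dimension `3`** (see the module docstring).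
[cite: Matsumura1987, Thm. 14.2; Liu2002, Thm. 8.1.19] [OURS · L1 W4.5b] toward `stub_elnat_tcPlusPlusPointResolution`
(stmt-ResolutionOfSingularities-20148 / -20038); NOT a statement of the manuscript; AI-written, weaker than expert review. -/
theorem hsub_reachTCPlusPlus_three (k : Type) [Field k] [IsAlgClosed k] :
    ∀ (O : Type) [CommRing O] [IsDomain O] [IsDiscreteValuationRing O] [IsAdicComplete (IsLocalRing.maximalIdeal O) O] [IsAlgClosed (IsLocalRing.ResidueField O)] (θ : O →+* k), Function.Surjective θ → ∀ (P : AlgebraicGeometry.Scheme.{0}) (q : P ⟶ AlgebraicGeometry.Spec (.of O)) (Y : Set P) (Ch : ∀ X' : AlgebraicGeometry.Scheme.{0}, (X' ⟶ P) → Set X' → Prop), (∀ (X' X'' : AlgebraicGeometry.Scheme.{0}) (σ' : X' ⟶ P) (S' : Set X') (C : X'.IdealSheafData) (τ : X'' ⟶ X'), Ch X' σ' S' → Literature.AlgebraicGeometry.Resolution.IsBlowup τ C → Literature.AlgebraicGeometry.Resolution.Scheme.IsRegular C.subscheme → AlgebraicGeometry.Flat (C.subschemeι ≫ σ' ≫ q)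 → σ' '' (C.support : Set X') ⊆ {y | ¬ IsGenericPoint y Y} → (C.support : Set X') ∩ (σ' ≫ q) ⁻¹' {IsLocalRing.closedPoint O} ⊆ S' → Ch X'' (τ ≫ σ') (closure (τ ⁻¹' (S' \ (C.support : Set X'))))) → (∀ (X' : AlgebraicGeometry.Scheme.{0}) (σ' : X' ⟶ P) (S' : Set X'), Ch X' σ' S' → Summit.ResolutionOfSingularities.ResolutionOfSingularities.Theses.EquisingularLift.Split.Chain P Y X' σ' S') → Y ⊆ q ⁻¹' {IsLocalRing.closedPoint O} → IsIrreducible Y → IsClosed Y → AlgebraicGeometry.IsIntegral P → IsLocallyNoetherian P → Literature.AlgebraicGeometry.Resolution.Scheme.IsRegular P → AlgebraicGeometry.IsProper q → AlgebraicGeometry.SmoothOfRelativeDimension 3 q → ∀ (X' : AlgebraicGeometry.Scheme.{0}) (σ' : X' ⟶ P) (S' : Set X'), Ch X' σ' S' → AlgebraicGeometry.IsIntegral X' → IsLocallyNoetherian X' → Literature.AlgebraicGeometry.Resolution.Scheme.IsRegular X' → AlgebraicGeometry.IsDominant (σ' ≫ q) → ∀ (F₁ : AlgebraicGeometry.Scheme.{0}),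 AlgebraicGeometry.IsIntegral F₁ → ∀ (j : F₁ ⟶ X') (t : F₁ ⟶ AlgebraicGeometry.Spec (.of k)), IsPullback j t (σ' ≫ q) (AlgebraicGeometry.Spec.map (CommRingCat.ofHom θ)) → ∀ (T₁ : Set F₁), IsClosed T₁ → IsIrreducible T₁ → j '' T₁ = S' → ∀ (x : F₁) (hx : IsClosed ({x} : Set F₁)) (U : X'.Opens), AlgebraicGeometry.Smooth (U.ι ≫ σ' ≫ q) → ∀ (s : AlgebraicGeometry.Spec (.of O) ⟶ X'), s ≫ σ' ≫ q = 𝟙 _ → s (IsLocalRing.closedPoint O) ∈ U → s (IsLocalRing.closedPoint O) = j x → ringKrullDim (X'.presheaf.stalk (s (IsLocalRing.closedPoint O))) = ((3 + 1 : ℕ) : WithBot ℕ∞) → IsRegularLocalRing (F₁.presheaf.stalk x) → (∀ c ∈ (s.ker.support : Set X'), ¬ IsGenericPoint (σ' c) Y) → ∀ (X₁ : AlgebraicGeometry.Scheme.{0}) (τ₁ : X₁ ⟶ X'), Literature.AlgebraicGeometry.Resolution.IsBlowup τ₁ s.ker → AlgebraicGeometry.IsIntegral X₁ → IsLocallyNoetherian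 X₁ → Literature.AlgebraicGeometry.Resolution.Scheme.IsRegular X₁ → AlgebraicGeometry.IsDominant ((τ₁ ≫ σ') ≫ q) → ∀ (F₂ : AlgebraicGeometry.Scheme.{0}), AlgebraicGeometry.IsIntegral F₂ → ∀ (υ : F₂ ⟶ F₁), Literature.AlgebraicGeometry.Resolution.IsBlowup υ (AlgebraicGeometry.Scheme.IdealSheafData.vanishingIdeal (⟨{x}, hx⟩ : TopologicalSpace.Closeds F₁)) → ∀ (j₂ : F₂ ⟶ X₁) (t₂ : F₂ ⟶ AlgebraicGeometry.Spec (.of k)), IsPullback j₂ t₂ ((τ₁ ≫ σ') ≫ q) (AlgebraicGeometry.Spec.map (CommRingCat.ofHom θ)) → j₂ ≫ τ₁ = υ ≫ j → (s.ker.comap τ₁).comap j₂ = (AlgebraicGeometry.Scheme.IdealSheafData.vanishingIdeal (⟨{x}, hx⟩ : TopologicalSpace.Closeds F₁)).comap υ → IsIrreducible (closure (υ ⁻¹' (T₁ \ {x}))) → Ch X₁ (τ₁ ≫ σ') (j₂ '' closure (υ ⁻¹' (T₁ \ {x}))) → ∀ (F₁₀ : AlgebraicGeometry.Scheme.{0})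 (β : F₁₀ ⟶ F₂) (T₁₀ : Set F₁₀), ReachTCPlusPlus₂ F₁ F₂ υ x (closure (υ ⁻¹' (T₁ \ {x}))) F₁₀ β T₁₀ → ∃ (X₉ : AlgebraicGeometry.Scheme.{0}) (σ₉ : X₉ ⟶ P) (S₉ : Set X₉) (j₉ : F₁₀ ⟶ X₉) (t₉ : F₁₀ ⟶ AlgebraicGeometry.Spec (.of k)), Ch X₉ σ₉ S₉ ∧ AlgebraicGeometry.IsIntegral X₉ ∧ IsLocallyNoetherian X₉ ∧ Literature.AlgebraicGeometry.Resolution.Scheme.IsRegular X₉ ∧ AlgebraicGeometry.IsDominant (σ₉ ≫ q) ∧ IsPullback j₉ t₉ (σ₉ ≫ q) (AlgebraicGeometry.Spec.map (CommRingCat.ofHom θ)) ∧ j₉ '' T₁₀ = S₉ ∧ IsClosed (T₁₀) ∧ IsIrreducible (T₁₀) ∧ AlgebraicGeometry.IsIntegral F₁₀ := by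
  intro O _ _ _ _ _ θ hθ P q Y Ch hChStep hChSplit hYsp hYirr hYcl hPint hPnoeth hPreg hqprop hqsm X' σ' S' hCh' hX'int hX'noeth
    hX'reg hX'dom F₁ hF₁ j t hsq T₁ hT₁cl hT₁irr hjT₁ x hx U hU s hs hsU hsx hdim hxreg hsoff X₁ τ₁ hτ₁ hX₁int hX₁noeth hX₁reg
    hX₁dom F₂ hF₂ υ hυ j₂ t₂ hsq₂ hcomm hcarrier hirr₂ hCh₁
  haveI := hPint
  haveI := hqprop
  haveI := hqsm
  haveI := hX'int
  haveI := hX'noeth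
  haveI := hF₁
  haveI := hX₁int
  haveI := hX₁noeth
  haveI := hF₂
  refine hsub_reachTCPlusPlus_of_invariant k 3 O θ hθ P q Y Ch hChStep hChSplit hYsp hYirr hYcl hPint hPnoeth hPreg hqprop hqsm X' σ'
    S' hCh' hX'int hX'noeth hX'reg hX'dom F₁ hF₁ j t hsq T₁ hT₁cl hT₁irr hjT₁ x hx U hU s hs hsU hsx hdim hxreg hsoff X₁ τ₁ hτ₁
    hX₁int hX₁noeth hX₁reg hX₁dom F₂ hF₂ υ hυ j₂ t₂ hsq₂ hcomm hcarrier hirr₂ hCh₁ (TCPlusPlus.Inv O k θ P q Y Ch) ?_ ?_ ?_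
  · -- (base) = res-type-100's `inv_base″` (D6)
    intro W _ _ _ _ hCC
    exact inv_base'' k O θ hθ P q Y Ch hChSplit hPnoeth hPreg X' σ' S' hCh' hX'reg F₁ j t hsq T₁ x hx s hs hsx hdim hsoff X₁ τ₁ hτ₁
      hX₁reg hX₁dom F₂ υ hυ j₂ t₂ hsq₂ hcomm hcarrier hCh₁ hirr₂ W hCC
  · -- (step) = `inv_step″`
    exact inv_step'' O k θ hθ P q Y hYsp hYirr hYcl hPnoeth hPreg Ch hChSplit hChStep
  · -- (final) = `inv_final″`
    exact inv_final'' O k θ hθ P q Y hYirr hYcl hPnoeth hPreg Ch hChSplit hChStep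

end Summit.ResolutionOfSingularities.ResolutionOfSingularities.Cruxes.EquisingularLiftNat.Sections

end
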